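import Summits.QuantumFields.YangMills.Statement
import Literature.MathematicalPhysics.QuantumFieldTheory.YangMillsOSOneSpecies
import HarnessLib
import HarnessLib.Audit.Tags

/-!
# QuantumFields / YangMills — anatomy of the summit statement (solo seat `solo-QuantumFields-informed`)

Kernel bookkeeping that isolates the two hard cores of `YangMills` and names them as obligation nodes.

* **Continuum core** (per `G, r, sch, Δ`): ONE hermitian scalar field `T₀ : OSData Unit 4` (E0, E0', E1–E4 on
  `ℝ⁴`) that is the off-diagonal limit along `sch` of the renormalised joint `n`-point functions of the curvature
  `tr F²` ALONE, non-trivial, non-Gaussian, with full-spectrum mass gap `Δ`. Closed form over all compact simple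
  `G`: `CurvatureContinuumCore`.
* **Lattice core** (per `G, r, sch, Δ`): the tree's `HasLatticeMassGap r sch Δ` — volume-uniform exponential
  clustering of every pair of gauge-invariant lattice observables at the scheme's couplings, rate `Δ` in physical
  units. Its weakest closed consequence over all compact simple `G`: `WeakCouplingLatticeGap` (rates `μ_k > 0` in
  lattice units, uncontrolled).
* `CurvatureAnatomy` — both cores for a COMMON `(r, sch, Δ)` with `β_k → ∞`; `yangMills_iff_curvatureAnatomy :
  YangMills ↔ CurvatureAnatomy` (`→`: restrict the all-species OS data to the curvature label; `←`: renormalise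
  every other species to zero, `zeroOff`, and extend the one-field data by zero — the tree's
  `exists_yangMillsWitness_of_oneSpecies`). So the `2^ℵ₀` species of the statement are free: no proof needs to say
  anything about any continuum observable but `tr F²`; the full-spectrum content sits in the lattice clause.
* `AnatomyEquivalence`, `AnatomyProjections` (proved propositions) — the equivalence, and the projections
  `YangMills → CurvatureContinuumCore`, `YangMills → WeakCouplingLatticeGap`. (The converse
  `CurvatureContinuumCore ∧ WeakCouplingLatticeGap → CurvatureAnatomy` is NOT claimed: the cores must hold along
  one scheme with matched rates `μ_k = Δ a_k`.)

`WeakCouplingLatticeGap` is typed with the SAME quantifier order as `HasLatticeMassGap` (`∀ A B, ∃ C, ∀ᶠ k`): the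
pair-dependent threshold is essential — the summit does not formally give clustering of all pairs at one common
coupling. It is the statement every infrared approach must reach and none does for a non-abelian Lie group in
`d = 4` (it holds for finite gauge groups and fails in the Coulomb phase of `U(1)`); see the seat's PLAN.md.

No facts, no axioms, no `sorry`: pure logic over the audited interface.
-/

open scoped SchwartzMap
open MeasureTheory Filter Topology
open Literature.MathematicalPhysics.AQFT Literature.MathematicalPhysics.QuantumLattice
open Literature.MathematicalPhysics.QuantumFieldTheory Literature.Probability.LatticeModels

noncomputable section

namespace Summit.QuantumFields.YangMills.Theorems

/-! ### Zeroing the renormalisation of every species but one -/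

section ZeroOff

variable {ι : Type}

/-- The scheme `sch` with the multiplicative renormalisation of every species other than `s₀` set to zero (same
spacings, couplings, volumes and counterterms). -/
def zeroOff (sch : SpeciesScheme ι) (s₀ : ι) : SpeciesScheme ι where
  a := sch.a
  a_pos := sch.a_pos
  tendsto_a := sch.tendsto_a
  β := sch.β
  L := sch.L
  tendsto_L := sch.tendsto_L
  c := fun s k => by classical exact if s = s₀ then sch.c s k else 0
  m := sch.m

/-- `zeroOff` keeps the renormalisation of `s₀`. -/
theorem zeroOff_c_self (sch : SpeciesScheme ι) (s₀ : ι) (k : ℕ) : (zeroOff sch s₀).c s₀ k = sch.c s₀ k := by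
  simp [zeroOff]

/-- `zeroOff` zeroes the renormalisation of every other species. -/
theorem zeroOff_c_of_ne (sch : SpeciesScheme ι) {s₀ s : ι} (h : s ≠ s₀) (k : ℕ) : (zeroOff sch s₀).c s k = 0 := by
  simp [zeroOff, h]

/-- `zeroOff` keeps the weak-coupling clause (it reads only `β`). -/
theorem hasWeakCouplingLimit_zeroOff (sch : SpeciesScheme ι) (s₀ : ι) :
    (zeroOff sch s₀).HasWeakCouplingLimit ↔ sch.HasWeakCouplingLimit := Iff.rfl

variable {G : Type} [Group G] [MeasurableSpace G] [TopologicalSpace G] [IsTopologicalGroup G]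
  [CompactSpace G] [BorelSpace G] {N : ℕ}

/-- `zeroOff` keeps the joint lattice `n`-point functions of the all-`s₀` strings. -/
theorem latticeSchwinger_zeroOff_const (ρ : G →* Matrix (Fin N) (Fin N) ℂ) (sch : SpeciesScheme ι) (s₀ : ι)
    (obs : ι → LGConfig 4 G → ℝ) (k n : ℕ) (f : Fin n → 𝓢(EuclideanSpace ℝ (Fin 4), ℝ)) :
    latticeSchwinger ρ (zeroOff sch s₀) obs k n (fun _ => s₀) f = latticeSchwinger ρ sch obs k n (fun _ => s₀) f := by
  unfold latticeSchwinger
  simp only [zeroOff_c_self]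
  rfl

/-- `zeroOff` keeps the all-observable lattice clause (it reads only `a`, `β`, `L`). -/
theorem hasLatticeMassGap_zeroOff (r : LatticeRep G) (sch : SpeciesScheme ι) (s₀ : ι) (Δ : ℝ) :
    HasLatticeMassGap r (zeroOff sch s₀) Δ ↔ HasLatticeMassGap r sch Δ := Iff.rfl

end ZeroOff

/-! ### The cores for one gauge group -/

section OneGroup

variable {G : Type} [Group G] [MeasurableSpace G] [TopologicalSpace G] [IsTopologicalGroup G]
  [CompactSpace G] [BorelSpace G]

/-- **Continuum core from a full witness**: restricting all-species OS data `T` with `IsYangMillsFor r sch T` to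
the curvature label gives one-field OS data that are the limit of the curvature strings, with the same
non-triviality, non-Gaussianity and gap. -/
theorem exists_oneField_of_isYangMillsFor (r : LatticeRep G) (sch : SpeciesScheme (YMSpecies G))
    {T : OSData (YMSpecies G) 4} (hYM : IsYangMillsFor r sch T) (hNT : T.IsNontrivial r.curvature)
    (hNG : T.IsNonGaussian r.curvature) {Δ : ℝ} (hgap : T.HasMassGap Δ) :
    ∃ T₀ : OSData Unit 4,
      (∀ n : ℕ, n ≠ 0 → ∀ (f : Fin n → 𝓢(EuclideanSpace ℝ (Fin 4), ℝ))
        (F : 𝓢((Fin n → EuclideanSpace ℝ (Fin 4)), ℂ)),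
        IsTensorOf F (fun i => ofRealTest (f i)) → IsOffDiagonal F →
          Tendsto (fun k : ℕ =>
            ((latticeSchwinger r.ρ sch (fun s => s.F) k n (fun _ => r.curvature) f : ℝ) : ℂ))
            atTop (𝓝 (T₀.schwinger n (fun _ => ()) F))) ∧
      T₀.IsNontrivial () ∧ T₀.IsNonGaussian () ∧ T₀.HasMassGap Δ := by
  obtain ⟨T₀, hlive, hdead⟩ := OSData.exists_extendByZero T (fun _ : Unit => r.curvature) (fun _ => True)
  refine ⟨T₀, fun n hn f F hF hoff => ?_, ?_, ?_, ?_⟩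
  · rw [OSData.schwinger_const_of_extendByZero T (fun _ : Unit => r.curvature) (fun _ => True) hlive trivial n]
    exact hYM n hn (fun _ => r.curvature) f F hF hoff
  · exact OSData.isNontrivial_of_extendByZero T (fun _ : Unit => r.curvature) (fun _ => True) hlive trivial hNT
  · exact OSData.isNonGaussian_of_extendByZero T (fun _ : Unit => r.curvature) (fun _ => True) hlive trivial hNG
  · exact OSData.hasMassGap_of_extendByZero T (fun _ : Unit => r.curvature) (fun _ => True) hlive hdead hgap

/-- **Full witness from the two cores**: one-field OS data that are the limit of the curvature strings along
`sch` (non-trivial, non-Gaussian, gap `Δ > 0`) and the lattice clause for `(r, sch, Δ)` give, for the scheme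
`zeroOff sch r.curvature` (same `a`, `β`, `L`), all-species OS data with every clause of the `YangMills` conclusion. -/
theorem exists_witness_of_cores (r : LatticeRep G) (sch : SpeciesScheme (YMSpecies G)) (T₀ : OSData Unit 4)
    (hconv : ∀ n : ℕ, n ≠ 0 → ∀ (f : Fin n → 𝓢(EuclideanSpace ℝ (Fin 4), ℝ))
      (F : 𝓢((Fin n → EuclideanSpace ℝ (Fin 4)), ℂ)),
      IsTensorOf F (fun i => ofRealTest (f i)) → IsOffDiagonal F →
        Tendsto (fun k : ℕ =>
          ((latticeSchwinger r.ρ sch (fun s => s.F) k n (fun _ => r.curvature) f : ℝ) : ℂ))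
          atTop (𝓝 (T₀.schwinger n (fun _ => ()) F)))
    (hNT : T₀.IsNontrivial ()) (hNG : T₀.IsNonGaussian ()) {Δ : ℝ} (hΔ : 0 < Δ) (hgap : T₀.HasMassGap Δ)
    (hIR : HasLatticeMassGap r sch Δ) :
    ∃ T : OSData (YMSpecies G) 4, IsYangMillsFor r (zeroOff sch r.curvature) T ∧
      T.IsNontrivial r.curvature ∧ T.IsNonGaussian r.curvature ∧
        ∃ Δ > 0, T.HasMassGap Δ ∧ HasLatticeMassGap r (zeroOff sch r.curvature) Δ := by
  refine exists_yangMillsWitness_of_oneSpecies r (zeroOff sch r.curvature)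
    (fun s hs k => zeroOff_c_of_ne sch hs k) T₀ (fun n hn f F hF hoff => ?_) hNT hNG hΔ hgap
    ((hasLatticeMassGap_zeroOff r sch r.curvature Δ).2 hIR)
  simp only [latticeSchwinger_zeroOff_const]
  exact hconv n hn f F hF hoff

end OneGroup

/-! ### The closed conjectures (obligation nodes) -/

/-- **Curvature anatomy of the summit.** For every compact simple `G`: a faithful unitary representation `r`, a
scheme `sch` with `β_k → +∞` and `Δ > 0` such that (continuum core) ONE hermitian scalar field `T₀` on `ℝ⁴` with
the OS axioms E0, E0', E1–E4 is the off-diagonal limit of the renormalised joint `n`-point functions of `tr F²` in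
the representation `r` along `sch`, non-trivial, non-Gaussian, with full mass gap `Δ`; and (lattice core) every
pair of gauge-invariant local lattice observables clusters exponentially at rate `Δ a_k` in lattice units,
uniformly in the torus size, at the scheme's couplings. EQUIVALENT to `YangMills`
(`yangMills_iff_curvatureAnatomy`). -/
@[conjecture] def CurvatureAnatomy : Prop :=
  ∀ (G : Type) [Group G] [TopologicalSpace G] [IsTopologicalGroup G] [CompactSpace G],
    IsCompactSimpleLieGroup G →
      letI : MeasurableSpace G := borel G
      haveI : BorelSpace G := ⟨rfl⟩
      ∃ (r : LatticeRep G) (sch : SpeciesScheme (YMSpecies G)),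
        sch.HasWeakCouplingLimit ∧ ∃ Δ > 0,
          (∃ T₀ : OSData Unit 4,
            (∀ n : ℕ, n ≠ 0 → ∀ (f : Fin n → 𝓢(EuclideanSpace ℝ (Fin 4), ℝ))
              (F : 𝓢((Fin n → EuclideanSpace ℝ (Fin 4)), ℂ)),
              IsTensorOf F (fun i => ofRealTest (f i)) → IsOffDiagonal F →
                Tendsto (fun k : ℕ =>
                  ((latticeSchwinger r.ρ sch (fun s => s.F) k n (fun _ => r.curvature) f : ℝ) : ℂ))
                  atTop (𝓝 (T₀.schwinger n (fun _ => ()) F))) ∧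
            T₀.IsNontrivial () ∧ T₀.IsNonGaussian () ∧ T₀.HasMassGap Δ) ∧
          HasLatticeMassGap r sch Δ

/-- **Continuum core of the summit** (the ultraviolet / construction half): for every compact simple `G`, a
faithful unitary representation `r`, a scheme with `β_k → +∞` and ONE hermitian scalar field `T₀` on `ℝ⁴`
satisfying the OS axioms E0, E0', E1–E4 that is the off-diagonal limit along the scheme of the renormalised
joint `n`-point functions of `tr F²`, non-trivial, non-Gaussian, with a full-spectrum mass gap `Δ > 0`. Implied
by `YangMills`; no converse (the lattice core is dropped). -/
@[conjecture] def CurvatureContinuumCore : Prop :=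
  ∀ (G : Type) [Group G] [TopologicalSpace G] [IsTopologicalGroup G] [CompactSpace G],
    IsCompactSimpleLieGroup G →
      letI : MeasurableSpace G := borel G
      haveI : BorelSpace G := ⟨rfl⟩
      ∃ (r : LatticeRep G) (sch : SpeciesScheme (YMSpecies G)),
        sch.HasWeakCouplingLimit ∧ ∃ Δ > 0, ∃ T₀ : OSData Unit 4,
          (∀ n : ℕ, n ≠ 0 → ∀ (f : Fin n → 𝓢(EuclideanSpace ℝ (Fin 4), ℝ))
            (F : 𝓢((Fin n → EuclideanSpace ℝ (Fin 4)), ℂ)),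
            IsTensorOf F (fun i => ofRealTest (f i)) → IsOffDiagonal F →
              Tendsto (fun k : ℕ =>
                ((latticeSchwinger r.ρ sch (fun s => s.F) k n (fun _ => r.curvature) f : ℝ) : ℂ))
                atTop (𝓝 (T₀.schwinger n (fun _ => ()) F))) ∧
          T₀.IsNontrivial () ∧ T₀.IsNonGaussian () ∧ T₀.HasMassGap Δ

/-- **Weak-coupling lattice gap** (the weakest infrared consequence of the summit): for every compact simple
`G`, a faithful unitary representation `r` (Wilson action `β ∑ₚ Re tr r.ρ(Uₚ)`), inverse couplings `β_k → +∞`,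
rates `μ_k > 0` (lattice units) and volumes `L_k` such that for every pair `A, B` of gauge-invariant local lattice
observables there is a constant `C` with, for all large `k`, on every periodic torus of side `2S + 1`, `S ≥ L_k`,
and all time separations `n ≤ S`: `|⟨A · τ_{n e₀} B⟩ − ⟨A⟩⟨B⟩| ≤ C e^{−μ_k n}` at coupling `β_k`. Exponential
clustering persists to arbitrarily weak coupling, uniformly in the volume — the negation of a massless (Coulomb /
deconfined) phase along the sequence. Same quantifier order as `HasLatticeMassGap` (pair-dependent threshold). -/
@[conjecture] def WeakCouplingLatticeGap : Prop :=
  ∀ (G : Type) [Group G] [TopologicalSpace G] [IsTopologicalGroup G] [CompactSpace G],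
    IsCompactSimpleLieGroup G →
      letI : MeasurableSpace G := borel G
      haveI : BorelSpace G := ⟨rfl⟩
      ∃ (r : LatticeRep G) (β μ : ℕ → ℝ) (L : ℕ → ℕ),
        Tendsto β atTop atTop ∧ (∀ k, 0 < μ k) ∧
          ∀ A B : YMSpecies G, ∃ C : ℝ, ∀ᶠ k in atTop, ∀ S : ℕ, L k ≤ S → ∀ n : ℕ, n ≤ S →
            |latticeConnectedCorr r.ρ (β k) (2 * S + 1) A.F B.F n| ≤ C * Real.exp (-(μ k * n))

/-! ### The anatomy theorem and the projections -/

/-- **`YangMills ↔ CurvatureAnatomy`.** The summit is exactly: weak-coupling scheme + one-field continuum limit of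
`tr F²` (OS axioms, non-trivial, non-Gaussian, gap `Δ`) + volume-uniform lattice clustering of all observables at
rate `Δ` in physical units, along one scheme. -/
theorem yangMills_iff_curvatureAnatomy : YangMills ↔ CurvatureAnatomy := by
  constructor
  · intro h G _ _ _ _ hG
    letI : MeasurableSpace G := borel G
    haveI : BorelSpace G := ⟨rfl⟩
    obtain ⟨r, sch, T, hw, hYM, hNT, hNG, Δ, hΔ, hgap, hlat⟩ := h G hG
    exact ⟨r, sch, hw, Δ, hΔ, exists_oneField_of_isYangMillsFor r sch hYM hNT hNG hgap, hlat⟩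
  · intro h G _ _ _ _ hG
    letI : MeasurableSpace G := borel G
    haveI : BorelSpace G := ⟨rfl⟩
    obtain ⟨r, sch, hw, Δ, hΔ, ⟨T₀, hconv, hNT, hNG, hgap⟩, hIR⟩ := h G hG
    obtain ⟨T, hT⟩ := exists_witness_of_cores r sch T₀ hconv hNT hNG hΔ hgap hIR
    exact ⟨r, zeroOff sch r.curvature, T, (hasWeakCouplingLimit_zeroOff sch r.curvature).2 hw, hT⟩

/-- **The anatomy equivalence** `YangMills ↔ CurvatureAnatomy`, as a proved proposition. -/
def AnatomyEquivalence : Prop := (YangMills ↔ CurvatureAnatomy)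

/-- `AnatomyEquivalence` holds: `yangMills_iff_curvatureAnatomy`. -/
theorem AnatomyEquivalence_holds : AnatomyEquivalence := yangMills_iff_curvatureAnatomy

/-- **The summit implies both closed cores**: `YangMills → CurvatureContinuumCore` (drop the lattice clause) and
`YangMills → WeakCouplingLatticeGap` (rates `μ_k = Δ a_k`, the scheme's couplings and volumes), as a proved
proposition. -/
def AnatomyProjections : Prop :=
  (YangMills → CurvatureContinuumCore) ∧ (YangMills → WeakCouplingLatticeGap)

/-- `AnatomyProjections` holds: through the anatomy, dropping one core each time. -/
theorem AnatomyProjections_holds : AnatomyProjections := by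
  refine ⟨fun h G _ _ _ _ hG => ?_, fun h G _ _ _ _ hG => ?_⟩
  · letI : MeasurableSpace G := borel G
    haveI : BorelSpace G := ⟨rfl⟩
    obtain ⟨r, sch, hw, Δ, hΔ, hUV, -⟩ := yangMills_iff_curvatureAnatomy.1 h G hG
    exact ⟨r, sch, hw, Δ, hΔ, hUV⟩
  · letI : MeasurableSpace G := borel G
    haveI : BorelSpace G := ⟨rfl⟩
    obtain ⟨r, sch, hw, Δ, hΔ, -, hlat⟩ := yangMills_iff_curvatureAnatomy.1 h G hG
    refine ⟨r, sch.β, fun k => Δ * sch.a k, sch.L, hw, fun k => mul_pos hΔ (sch.a_pos k), fun A B => ?_⟩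
    obtain ⟨C, hC⟩ := hlat A B
    refine ⟨C, hC.mono fun k hk S hS n hn => ?_⟩
    simpa [mul_assoc] using hk S hS n hn

end Summit.QuantumFields.YangMills.Theorems

end
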